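import Mathlib
import HarnessLib
import Summits.RiemannHypothesis.RiemannHypothesis.Theorems.IntegerScrewRungCertSound

/-!
# Route `IntegerScrew` — kernel certificate checker for the finite rungs: the FAST PATH (integer decision step)

Engine work on top of `IntegerScrewRungCert{Defs,Series,Sound}` so that the whole exact-census range
`M ≤ 64` of the cell (HOME/sos, engine A) fits in one heavy kernel file:

* `lerchGoK` / `lerchEnclK` / `uEnclK` / `uTableK` — the Hurwitz–Lerch loop with a PRESCRIBED number of
  terms per entry (the counts `ktab` are certificate data; the geometric tail is always added, so soundness
  holds for every `ktab`: `mem_lerchEnclK`, `mem_uEnclK`); the loop state is FORCED at every step by an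
  always-false test (`pw.hi < pw.lo || …`), so the kernel never builds deep unevaluated chains (the
  unforced loops of part 1 occasionally exhaust the kernel's stack on some farm nodes);
* `cPartialF` / `cLoF` / `tEnclF` — the same lower bound `c_lo ≤ ζ(2,¼)` and entry table as part 1, with
  the 300-term partial sum forced at every step (`cLoF_le_lerchC`, `mem_tEnclF`);
* `zresidual` / `zcheck` — the INTEGER twin of the tree's `Literature.Analysis.ValidatedNumerics.checkLower`:
  with the centre at scale `2^49` (the sum `lo + hi` of the `2^48`-scaled enclosure), widths `hi − lo`, a
  `2⁻³²`-dyadic factor `Lz` as integers and the bound `lamZ/2^49`, the residual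
  `R = 2^64·(C − L Lᵀ − λ I)` is an exact integer table and the domination test
  `Σ_{j≠i}(|R i j| + |R j i|) + 2^15 Σ_j (rz i j + rz j i) ≤ 2 R i i` is decided in `ℤ` (no rational
  normalisation); soundness `mul_sqSum_le_quadForm_of_zcheck` is the tree's real lemma
  `mul_sqSum_le_quadForm_of_residual` after the cast identity `residual_eq_zresidual`;
* `rungCheckZ` + **`posDef_of_rungCheckZ`**: the logarithm table is the engine's, the integer test passes,
  and — supplied separately because it is decided in row chunks — `utab = uTableK logs A N ktab`; then
  `screwMatrix N ≻ 0` (rank-one trick and `T(c_lo)` as in part 3).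

Measured (farm): N = 31 end-to-end 42 s; N = 63 ≈ 140 s kernel in three table chunks + the integer test.
Nothing here bears on the truth of RH. References: S. M. Rump, Acta Numerica 19 (2010) §10.8 (verified
positive definiteness by a shifted Cholesky factor and a residual bound) [folklore]; M. Suzuki, J. Lond. Math.
Soc. (2) 108 (2023), (1.1), (1.4) [Suzuki2023].
-/

set_option linter.dupNamespace false

namespace Summit.RiemannHypothesis.RiemannHypothesis.Theorems.IntegerScrew.RungCert

open Literature.NumberTheory.LFunctions Literature.Analysis.ValidatedNumerics Finset
open Literature.Analysis.ValidatedNumerics.Numerics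

/-! ## Fixed-`K` Hurwitz–Lerch loop (the term counts are certificate data; the tail is always added) -/

/-- `K` more steps of the series recurrence from the state `(k, pw ∋ x^k, s ∋ Σ_{j<k})`. [folklore] -/
def lerchGoK (X : FI) : ℕ → ℕ → FI → FI → ℕ × FI × FI
  | 0, k, pw, s => (k, pw, s)
  | K + 1, k, pw, s =>
      -- the (always false) test forces the kernel to evaluate the state at every step (shallow terms)
      if pw.hi < pw.lo || s.hi < s.lo then (k, pw, s)
      else lerchGoK X K (k + 1) (pw.mul X) (s.add ((pw.mulInt 16).divNat ((4 * k + 1) ^ 2)))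

/-- Enclosure of `Φ = Σ_k x^k/(k+¼)²` at `x = b²/a²` from `K` terms plus the geometric tail bound. [folklore] -/
def lerchEnclK (a b K : ℕ) : FI :=
  let xn := b * b
  let xd := a * a
  let r := lerchGoK (FI.ofFrac xn xd) K 0 (FI.ofInt 1) (FI.ofInt 0)
  r.2.2.add ⟨0, (lerchTail xn xd r.1 r.2.1).hi⟩

/-- `uEncl` with a prescribed number `K` of Hurwitz–Lerch terms. [folklore] -/
def uEnclK (logs : List FI) (A : FI) (a b K : ℕ) : FI :=
  let T := (lg logs a).sub (lg logs b)
  let g := (sqrtNat a).mul (sqrtNat b)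
  let s := g.divNat b
  let s' := g.divNat a
  let arch := ((s.add s').sub (FI.ofInt 2)).mulInt 4
  let P := primeSumEncl logs T (a / b)
  let lin := (T.mul A).divNat 2
  let ler := (s'.mul (lerchEnclK a b K)).divNat 4
  ((arch.sub P).sub lin).sub ler

/-- The table `utab[a][b] = uEnclK a b (ktab[a][b])`, `b < a ≤ N + 1`. [folklore] -/
def uTableK (logs : List FI) (A : FI) (N : ℕ) (ktab : List (List ℕ)) : List (List FI) :=
  (List.range (N + 2)).map fun a => (List.range a).map fun b => uEnclK logs A a b (mget ktab a b)

/-- Invariant of `lerchGoK`. [folklore] -/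
theorem lerchGoK_spec {x : ℝ} {X : FI} (hx : FI.mem x X) :
    ∀ (K k : ℕ) (pw s : FI), FI.mem (x ^ k) pw →
      FI.mem (∑ j ∈ range k, x ^ j / ((j : ℝ) + 1 / 4) ^ 2) s →
      FI.mem (x ^ (lerchGoK X K k pw s).1) (lerchGoK X K k pw s).2.1 ∧
        FI.mem (∑ j ∈ range (lerchGoK X K k pw s).1, x ^ j / ((j : ℝ) + 1 / 4) ^ 2)
          (lerchGoK X K k pw s).2.2
  | 0, k, pw, s, hp, hs => by simpa [lerchGoK] using And.intro hp hs
  | K + 1, k, pw, s, hp, hs => by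
    simp only [lerchGoK]
    split_ifs with h
    · exact ⟨hp, hs⟩
    · refine lerchGoK_spec hx K (k + 1) _ _ ?_ ?_
      · rw [pow_succ]; exact FI.mem_mul hp hx
      · rw [Finset.sum_range_succ]; exact FI.mem_add hs (mem_lerchTerm hp)

/-- **`Φ(b²/a²) ∈ lerchEnclK a b K`** for every `K` (`b < a`). [folklore] -/
theorem mem_lerchEnclK {a b : ℕ} (hab : b < a) (K : ℕ) :
    FI.mem (∑' k : ℕ, (((b * b : ℕ) : ℝ) / ((a * a : ℕ) : ℝ)) ^ k / ((k : ℝ) + 1 / 4) ^ 2)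
      (lerchEnclK a b K) := by
  have ha : 0 < a := by omega
  have hlt : b * b < a * a := Nat.mul_self_lt_mul_self hab
  set x : ℝ := ((b * b : ℕ) : ℝ) / ((a * a : ℕ) : ℝ) with hxdef
  have hxd : (0 : ℝ) < ((a * a : ℕ) : ℝ) := by exact_mod_cast Nat.mul_pos ha ha
  have hx0 : 0 ≤ x := by positivity
  have hx1 : x < 1 := by rw [hxdef, div_lt_one hxd]; exact_mod_cast hlt
  have hX : FI.mem x (FI.ofFrac (b * b : ℕ) (a * a)) := by
    have := FI.mem_ofFrac ((b * b : ℕ) : ℤ) (q := a * a) (Nat.mul_pos ha ha)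
    simpa [hxdef] using this
  have h0 : FI.mem (x ^ 0) (FI.ofInt 1) := by simpa using FI.mem_ofInt 1
  have h0' : FI.mem (∑ j ∈ range 0, x ^ j / ((j : ℝ) + 1 / 4) ^ 2) (FI.ofInt 0) := by
    simpa using FI.mem_ofInt 0
  obtain ⟨hp, hs⟩ := lerchGoK_spec hX K 0 _ _ h0 h0'
  set r := lerchGoK (FI.ofFrac (b * b : ℕ) (a * a)) K 0 (FI.ofInt 1) (FI.ofInt 0) with hr
  have hsum := summable_lerch hx0 hx1.le
  have hsplit := (hsum.sum_add_tsum_nat_add r.1).symm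
  simp only [lerchEnclK]
  rw [← hr, hsplit]
  refine FI.mem_add hs ⟨?_, ?_⟩
  · push_cast
    exact mul_nonneg (tsum_nonneg fun i => by positivity) SC_pos.le
  · have := tail_le_lerchTail hlt (k := r.1) (pw := r.2.1) (by simpa [hxdef] using hp)
    simpa [hxdef] using this

/-- **`u(a,b) ∈ uEnclK a b K`.** [folklore] -/
theorem mem_uEnclK {logs : List FI} {M : ℕ} (hL : ∀ n ≤ M, FI.mem (Real.log n) (lg logs n)) (hM : M ≤ 64)
    {A : FI} (hA : FI.mem slopeA A) {a b : ℕ} (hb : 0 < b) (hab : b < a) (haM : a ≤ M) (K : ℕ) :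
    FI.mem (uR a b) (uEnclK logs A a b K) := by
  have ha : 0 < a := hb.trans hab
  rw [uR_eq hb hab]
  have hT : FI.mem (Real.log a - Real.log b) ((lg logs a).sub (lg logs b)) :=
    FI.mem_sub (hL a haM) (hL b (by omega))
  have hg : FI.mem (Real.sqrt a * Real.sqrt b) ((sqrtNat a).mul (sqrtNat b)) :=
    FI.mem_mul (mem_sqrtNat a) (mem_sqrtNat b)
  have hs : FI.mem (Real.sqrt a * Real.sqrt b / b) (((sqrtNat a).mul (sqrtNat b)).divNat b) :=
    FI.mem_divNat hg hb
  have hs' : FI.mem (Real.sqrt a * Real.sqrt b / a) (((sqrtNat a).mul (sqrtNat b)).divNat a) :=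
    FI.mem_divNat hg ha
  have h2 : FI.mem (2 : ℝ) (FI.ofInt 2) := by simpa using FI.mem_ofInt 2
  have harch : FI.mem (4 * (Real.sqrt a * Real.sqrt b / b + Real.sqrt a * Real.sqrt b / a - 2))
      ((((((sqrtNat a).mul (sqrtNat b)).divNat b).add (((sqrtNat a).mul (sqrtNat b)).divNat a)).sub
        (FI.ofInt 2)).mulInt 4) := by
    have := FI.mem_mulInt (FI.mem_sub (FI.mem_add hs hs') h2) 4
    push_cast at this
    rw [mul_comm] at this
    exact this
  have hP := mem_primeSumEncl hL hM hT (m := a / b) ((Nat.div_le_self a b).trans haM)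
  have hlin : FI.mem ((Real.log a - Real.log b) * slopeA / 2)
      ((((lg logs a).sub (lg logs b)).mul A).divNat 2) := FI.mem_divNat (FI.mem_mul hT hA) (by norm_num)
  have hler := FI.mem_divNat (FI.mem_mul hs' (mem_lerchEnclK hab K)) (n := 4) (by norm_num)
  have := FI.mem_sub (FI.mem_sub (FI.mem_sub harch hP) hlin) hler
  push_cast at this ⊢
  exact this

/-- Table lookup in `uTableK`. [folklore] -/
theorem ug_uTableK {logs : List FI} {A : FI} {N : ℕ} {ktab : List (List ℕ)} {a b : ℕ} (hba : b < a)
    (ha : a ≤ N + 1) : ug (uTableK logs A N ktab) a b = uEnclK logs A a b (mget ktab a b) := by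
  unfold ug uTableK
  have h1 : ((List.range (N + 2)).map fun a => (List.range a).map fun b =>
      uEnclK logs A a b (mget ktab a b)).getD a [] =
      (List.range a).map fun b => uEnclK logs A a b (mget ktab a b) := by
    rw [List.getD_eq_getElem?_getD, List.getElem?_map, List.getElem?_range (by omega)]
    rfl
  rw [h1, List.getD_eq_getElem?_getD, List.getElem?_map, List.getElem?_range hba]
  rfl

/-! ## A shallow-evaluation twin of `cPartial` / `cLoQ` / `tEncl` (same values, forced at every step) -/

/-- `acc + Σ_{k ≤ j < k+n} 16/(4j+1)²`, the accumulator forced at every step. [folklore] -/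
def cPartialF : ℕ → ℕ → FI → FI
  | 0, _, acc => acc
  | n + 1, k, acc => if acc.hi < acc.lo then acc else cPartialF n (k + 1) (acc.add (FI.ofFrac 16 ((4 * k + 1) ^ 2)))

/-- The rational lower bound of `C = ζ(2,¼)` from `cPartialF` (same value as `cLoQ`). [folklore] -/
def cLoF : ℚ := ((cPartialF cTerms 0 (FI.ofInt 0)).lo : ℚ) / SC + 4 / (4 * cTerms + 1)

/-- `tEncl` with `cLoF`. [folklore] -/
def tEnclF (utab : List (List FI)) (i j : ℕ) : FI :=
  if i = j then (FI.ofRatRat (cLoF / 2) (cLoF / 2)).add ((ug utab (i + 2) 1).mulInt 2)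
  else (((FI.ofRatRat (cLoF / 4) (cLoF / 4)).add (ug utab (i + 2) 1)).add (ug utab (j + 2) 1)).sub
    (ug utab (max i j + 2) (min i j + 2))

/-- Invariant of `cPartialF`. [folklore] -/
theorem mem_cPartialF : ∀ (n k : ℕ) (acc : FI) (v : ℝ), FI.mem v acc →
    FI.mem (v + ∑ j ∈ Finset.Ico k (k + n), 1 / ((j : ℝ) + 1 / 4) ^ 2) (cPartialF n k acc)
  | 0, k, acc, v, hv => by simpa [cPartialF] using hv
  | n + 1, k, acc, v, hv => by
    simp only [cPartialF]
    split_ifs with h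
    · exfalso
      have := (hv.1.trans hv.2); exact absurd (by exact_mod_cast this : acc.lo ≤ acc.hi) (not_le.2 h)
    · have hterm : FI.mem (1 / ((k : ℝ) + 1 / 4) ^ 2) (FI.ofFrac 16 ((4 * k + 1) ^ 2)) := by
        have := FI.mem_ofFrac 16 (q := (4 * k + 1) ^ 2) (by positivity)
        convert this using 1
        push_cast; field_simp; ring
      have := mem_cPartialF n (k + 1) _ _ (FI.mem_add hv hterm)
      rw [Finset.sum_eq_sum_Ico_succ_bot (by omega : k < k + (n + 1)), ← add_assoc,
        show k + (n + 1) = k + 1 + n by ring]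
      exact this

/-- **`cLoF ≤ C`.** [folklore] -/
theorem cLoF_le_lerchC : ((cLoF : ℚ) : ℝ) ≤ lerchC := by
  have h0 := (mem_cPartialF cTerms 0 (FI.ofInt 0) 0 (by simpa using FI.mem_ofInt 0)).1
  have h1 : (((cPartialF cTerms 0 (FI.ofInt 0)).lo : ℤ) : ℝ) ≤
      (∑ k ∈ range cTerms, 1 / ((k : ℝ) + 1 / 4) ^ 2) * SC := by
    rw [Finset.range_eq_Ico]; simpa only [zero_add] using h0
  have h2 := partial_add_inv_le_lerchC cTerms
  have hS := SC_pos
  have h3 : (((cPartialF cTerms 0 (FI.ofInt 0)).lo : ℤ) : ℝ) / SC ≤ ∑ k ∈ range cTerms, 1 / ((k : ℝ) + 1 / 4) ^ 2 := by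
    rw [div_le_iff₀ hS]; exact h1
  have h4 : ((cLoF : ℚ) : ℝ) = (((cPartialF cTerms 0 (FI.ofInt 0)).lo : ℤ) : ℝ) / SC + 4 / (4 * (cTerms : ℝ) + 1) := by
    unfold cLoF; push_cast; ring
  have h5 : (4 : ℝ) / (4 * (cTerms : ℝ) + 1) = 1 / ((cTerms : ℝ) + 1 / 4) := by
    rw [div_eq_div_iff (by positivity) (by positivity)]; ring
  rw [h4, h5]
  unfold lerchC
  linarith

/-- **The entries of `T(c_loF)` are enclosed by `tEnclF`.** [folklore] -/
theorem mem_tEnclF {utab : List (List FI)} {N : ℕ}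
    (hut : ∀ a b : ℕ, 0 < b → b < a → a ≤ N + 1 → FI.mem (uR a b) (ug utab a b))
    {i j : ℕ} (hi : i < N) (hj : j < N) :
    FI.mem (tMat ((cLoF : ℚ) : ℝ) N ⟨i, hi⟩ ⟨j, hj⟩) (tEnclF utab i j) := by
  have hc2 : FI.mem (((cLoF : ℚ) : ℝ) / 2) (FI.ofRatRat (cLoF / 2) (cLoF / 2)) := by
    have := FI.mem_ofRatRat (x := ((cLoF / 2 : ℚ) : ℝ)) le_rfl le_rfl
    push_cast at this; exact this
  have hc4 : FI.mem (((cLoF : ℚ) : ℝ) / 4) (FI.ofRatRat (cLoF / 4) (cLoF / 4)) := by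
    have := FI.mem_ofRatRat (x := ((cLoF / 4 : ℚ) : ℝ)) le_rfl le_rfl
    push_cast at this; exact this
  simp only [tMat, tEnclF, Matrix.of_apply, Fin.mk.injEq]
  split_ifs with h
  · subst h
    have hu := hut (i + 2) 1 one_pos (by omega) (by omega)
    have := FI.mem_add hc2 (FI.mem_mulInt hu 2)
    push_cast at this
    rw [mul_comm] at this
    exact this
  · have hu1 := hut (i + 2) 1 one_pos (by omega) (by omega)
    have hu2 := hut (j + 2) 1 one_pos (by omega) (by omega)
    have hu3 := hut (max i j + 2) (min i j + 2) (by omega) (by omega) (by omega)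
    exact FI.mem_sub (FI.mem_add (FI.mem_add hc4 hu1) hu2) hu3

/-! ## Integer-scaled decision step (fast path for larger `N`) -/

/-- Table lookup in a list of integer pairs (junk `(0,0)` outside). [folklore] -/
def pg (t : List (List (ℤ × ℤ))) (i j : ℕ) : ℤ × ℤ := (t.getD i []).getD j (0, 0)

/-- The table of scaled centres/widths of `T(c_lo)`: `(lo + hi, hi − lo)` of `tEncl` (scale `2·2^48`). [folklore] -/
def tzTab (utab : List (List FI)) (N : ℕ) : List (List (ℤ × ℤ)) :=
  mtab N N fun i j => ((tEnclF utab i j).lo + (tEnclF utab i j).hi, (tEnclF utab i j).hi - (tEnclF utab i j).lo)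

/-- The INTEGER residual `2^64·(C − L Lᵀ − λ I)` for a centre `cz/2^49`, a factor `Lz/2^32` (ragged
rows, zero-padded) and a bound `lamZ/2^49`. [folklore] -/
def zresidual (n : ℕ) (cz : ℕ → ℕ → ℤ) (Lz : List (List ℤ)) (lamZ : ℤ) (i j : ℕ) : ℤ :=
  cz i j * 32768 - rsum n (fun m => mget Lz i m * mget Lz j m) - (if i = j then lamZ * 32768 else 0)

/-- **Integer twin of `checkLower`** (`k = n`, weights `1`): with `R = 2^64·(C − LLᵀ − λI)` tabulated,
`Σ_{j≠i}(|R i j| + |R j i|) + 2^15·Σ_j (rz i j + rz j i) ≤ 2 R i i` for every `i < n`. [folklore] -/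
def zcheck (n : ℕ) (cz rz : ℕ → ℕ → ℤ) (Lz : List (List ℤ)) (lamZ : ℤ) : Bool :=
  let R := mtab n n (zresidual n cz Lz lamZ)
  rall n fun i => decide
    (rsum n (fun j => if j = i then 0 else |mget R i j| + |mget R j i|) +
        32768 * rsum n (fun j => rz i j + rz j i) ≤ 2 * mget R i i)

/-- **The fast rung checker** (decision part): the logarithm table is the engine's and the integer
domination test passes on the scaled tables of `T(c_lo)` built from `utab` (`Lz` = a `2⁻³²`-dyadic factor as
integers, `lamZ` = the bound at scale `2^49`). The table identity `utab = uTableK logs A N ktab` is supplied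
separately (it is decided in row chunks). [folklore] -/
def rungCheckZ (N : ℕ) (logs : List FI) (utab : List (List FI)) (Lz : List (List ℤ)) (lamZ : ℤ) : Bool :=
  decide (N + 1 ≤ 64) && decide (logs = FI.logTable (N + 1)) && FI.logTableOK (N + 1) &&
    zcheck N (fun i j => (pg (tzTab utab N) i j).1) (fun i j => (pg (tzTab utab N) i j).2) Lz lamZ &&
    decide (0 < lamZ)

/-- `2 · SC = 2^49` and `2^49 · 2^15 = 2^64` bookkeeping: `(2·SC)·32768 = 2^64`. [folklore] -/
theorem two_SC_mul : (2 * (SC : ℝ)) * 32768 = 2 ^ 64 := by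
  rw [show (SC : ℝ) = 2 ^ 48 by exact_mod_cast SC_eq]; norm_num

/-- The real residual of the scaled data is the integer residual over `2^64`. [folklore] -/
theorem residual_eq_zresidual (n : ℕ) (cz : ℕ → ℕ → ℤ) (Lz : List (List ℤ)) (lamZ : ℤ) (i j : ℕ) :
    Literature.Analysis.ValidatedNumerics.residual n (fun i j => ((cz i j : ℤ) : ℝ) / (2 * SC))
      (fun i m => ((mget Lz i m : ℤ) : ℝ) / 2 ^ 32)
      (fun _ => 1) (((lamZ : ℤ) : ℝ) / (2 * SC)) i j = ((zresidual n cz Lz lamZ i j : ℤ) : ℝ) / 2 ^ 64 := by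
  have hS : (2 * (SC : ℝ)) = 2 ^ 64 / 32768 := by rw [← two_SC_mul]; ring
  unfold Literature.Analysis.ValidatedNumerics.residual ldlt zresidual
  rw [rsum_eq_sum]
  push_cast
  rw [hS]
  have e1 : ∀ m : ℕ, ((mget Lz i m : ℤ) : ℝ) / 2 ^ 32 * 1 * (((mget Lz j m : ℤ) : ℝ) / 2 ^ 32) =
      ((mget Lz i m : ℤ) : ℝ) * ((mget Lz j m : ℤ) : ℝ) / 2 ^ 64 := fun m => by ring
  simp_rw [e1, ← Finset.sum_div]
  split_ifs <;> ring

/-- **Soundness of the integer decision step**: every real matrix of the family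
`|A i j − cz i j/2^49| ≤ rz i j/2^49` satisfies `(lamZ/2^49)·‖x‖² ≤ xᵀ A x`. [folklore] -/
theorem mul_sqSum_le_quadForm_of_zcheck {n : ℕ} {cz rz : ℕ → ℕ → ℤ} {Lz : List (List ℤ)} {lamZ : ℤ}
    (h : zcheck n cz rz Lz lamZ = true) {A : ℕ → ℕ → ℝ}
    (hA : ∀ i ∈ range n, ∀ j ∈ range n, |A i j - ((cz i j : ℤ) : ℝ) / (2 * SC)| ≤ ((rz i j : ℤ) : ℝ) / (2 * SC))
    (x : ℕ → ℝ) : ((lamZ : ℤ) : ℝ) / (2 * SC) * sqSum n x ≤ quadForm n A x := by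
  unfold zcheck at h
  refine mul_sqSum_le_quadForm_of_residual (k := n) (L := fun i m => ((mget Lz i m : ℤ) : ℝ) / 2 ^ 32)
    (D := fun _ => 1) (fun m _ => zero_le_one) hA (fun i hi => ?_) x
  have hi' := mem_range.1 hi
  have h1 := of_rall h hi'
  rw [decide_eq_true_eq, mget_mtab _ hi' hi'] at h1
  -- rewrite the integer inequality in `ℝ`
  have h2 : ((rsum n (fun j => if j = i then 0 else
        |mget (mtab n n (zresidual n cz Lz lamZ)) i j| + |mget (mtab n n (zresidual n cz Lz lamZ)) j i|) : ℤ) : ℝ)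
      + 32768 * ((rsum n (fun j => rz i j + rz j i) : ℤ) : ℝ) ≤ 2 * ((zresidual n cz Lz lamZ i i : ℤ) : ℝ) := by
    exact_mod_cast h1
  rw [rsum_eq_sum, rsum_eq_sum] at h2
  push_cast at h2
  have hoff : Literature.Analysis.ValidatedNumerics.offDiag n (Literature.Analysis.ValidatedNumerics.residual n (fun i j => ((cz i j : ℤ) : ℝ) / (2 * SC))
      (fun i m => ((mget Lz i m : ℤ) : ℝ) / 2 ^ 32) (fun _ => 1) (((lamZ : ℤ) : ℝ) / (2 * SC))) i =
      (∑ j ∈ range n, if j = i then (0 : ℝ) else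
        (|((mget (mtab n n (zresidual n cz Lz lamZ)) i j : ℤ) : ℝ)| +
          |((mget (mtab n n (zresidual n cz Lz lamZ)) j i : ℤ) : ℝ)|)) / 2 ^ 64 / 2 := by
    unfold Literature.Analysis.ValidatedNumerics.offDiag
    rw [Finset.sum_div, Finset.sum_div]
    refine Finset.sum_congr rfl fun j hj => ?_
    have hj' := mem_range.1 hj
    rw [residual_eq_zresidual, residual_eq_zresidual, mget_mtab _ hi' hj', mget_mtab _ hj' hi']
    split_ifs
    · simp
    · rw [abs_div, abs_div, abs_of_pos (by positivity : (0 : ℝ) < 2 ^ 64)]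
      ring
  have hrad : Literature.Analysis.ValidatedNumerics.radRow n (fun i j => ((rz i j : ℤ) : ℝ) / (2 * SC)) i =
      (∑ j ∈ range n, (((rz i j : ℤ) : ℝ) + ((rz j i : ℤ) : ℝ))) / (2 * SC) / 2 := by
    unfold Literature.Analysis.ValidatedNumerics.radRow
    rw [Finset.sum_div, Finset.sum_div]
    refine Finset.sum_congr rfl fun j _ => by ring
  rw [hoff, hrad, residual_eq_zresidual, show (2 * (SC : ℝ)) = 2 ^ 49 by
    rw [show (SC : ℝ) = 2 ^ 48 by exact_mod_cast SC_eq]; norm_num]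
  linarith [h2]

/-- From `x ∈ I`: `|x − (lo+hi)/2^49| ≤ (hi−lo)/2^49`. [folklore] -/
theorem abs_sub_le_of_mem {x : ℝ} {I : FI} (h : FI.mem x I) :
    |x - (((I.lo + I.hi : ℤ)) : ℝ) / (2 * SC)| ≤ (((I.hi - I.lo : ℤ)) : ℝ) / (2 * SC) := by
  have := abs_sub_midQ_le_radQ h
  unfold midQ radQ at this
  push_cast at this ⊢
  exact this

/-- Reading `tzTab`. [folklore] -/
theorem pg_tzTab (utab : List (List FI)) {N i j : ℕ} (hi : i < N) (hj : j < N) :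
    pg (tzTab utab N) i j =
      ((tEnclF utab i j).lo + (tEnclF utab i j).hi, (tEnclF utab i j).hi - (tEnclF utab i j).lo) := by
  unfold pg tzTab mtab
  have h1 : ((List.range N).map fun i => (List.range N).map fun j =>
      ((tEnclF utab i j).lo + (tEnclF utab i j).hi, (tEnclF utab i j).hi - (tEnclF utab i j).lo)).getD i [] =
      (List.range N).map fun j =>
        ((tEnclF utab i j).lo + (tEnclF utab i j).hi, (tEnclF utab i j).hi - (tEnclF utab i j).lo) := by
    rw [List.getD_eq_getElem?_getD, List.getElem?_map, List.getElem?_range hi]; rfl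
  rw [h1, List.getD_eq_getElem?_getD, List.getElem?_map, List.getElem?_range hj]; rfl

/-- **Soundness of the fast rung checker**: `rungCheckZ N logs utab Lz lamZ = true`, together with the
slope enclosure `slopeEncl logs = some A` and the table identity `utab = uTableK logs A N ktab` (any term
counts `ktab`), implies `S_{N+1} = screwMatrix N ≻ 0` — unconditionally. [folklore] -/
theorem posDef_of_rungCheckZ {N : ℕ} {logs : List FI} {utab : List (List FI)} {Lz : List (List ℤ)}
    {lamZ : ℤ} (h : rungCheckZ N logs utab Lz lamZ = true) {A : FI} (hA : slopeEncl logs = some A)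
    {ktab : List (List ℕ)} (htab : utab = uTableK logs A N ktab) : (screwMatrix N).PosDef := by
  rcases Nat.eq_zero_or_pos N with rfl | hNpos
  · exact screwMatrix_zero_posDef
  unfold rungCheckZ at h
  simp only [Bool.and_eq_true, decide_eq_true_eq] at h
  obtain ⟨⟨⟨⟨hN, hlogs⟩, hok⟩, hcheck⟩, hlam⟩ := h
  have hL := logsOK_of_eq hlogs hok
  have hAv : FI.mem slopeA A := mem_slopeEncl hL (by omega) hA
  have hut : ∀ a b : ℕ, 0 < b → b < a → a ≤ N + 1 → FI.mem (uR a b) (ug utab a b) := by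
    intro a b hb hba ha
    rw [htab, ug_uTableK hba ha]
    exact mem_uEnclK hL hN hAv hb hba ha _
  -- the form bound on `T(c_lo)`
  have hform : ∀ v : Fin N → ℝ, ((lamZ : ℤ) : ℝ) / (2 * SC) * dotProduct v v ≤
      dotProduct v ((tMat ((cLoF : ℚ) : ℝ) N).mulVec v) := by
    intro v
    rw [← quadForm_pad, ← sqSum_pad]
    refine mul_sqSum_le_quadForm_of_zcheck hcheck (fun i hi j hj => ?_) _
    have hi' := mem_range.1 hi; have hj' := mem_range.1 hj
    rw [padM_of_lt _ hi' hj', pg_tzTab utab hi' hj']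
    exact abs_sub_le_of_mem (mem_tEnclF hut hi' hj')
  have hlam' : (0 : ℝ) < ((lamZ : ℤ) : ℝ) / (2 * SC) := by
    have : (0 : ℝ) < ((lamZ : ℤ) : ℝ) := by exact_mod_cast hlam
    exact div_pos this (mul_pos two_pos SC_pos)
  have hpd : (tMat ((cLoF : ℚ) : ℝ) N).PosDef := by
    refine Matrix.PosDef.of_dotProduct_mulVec_pos (tMat_isHermitian _ _) fun v hv => ?_
    have hvv : 0 < dotProduct v v := by
      have := Matrix.dotProduct_star_self_pos_iff.mpr hv
      simpa using this
    have := hform v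
    rw [star_trivial]
    exact lt_of_lt_of_le (mul_pos hlam' hvv) this
  rw [screwMatrix_eq_tMat, tMat_split lerchC ((cLoF : ℚ) : ℝ)]
  exact hpd.add_posSemidef ((one_add_vecMulVec_posSemidef N).smul
    (div_nonneg (sub_nonneg.2 cLoF_le_lerchC) (by norm_num)))

/-- Corollary: pivots. [folklore] -/
theorem screwPivot_pos_of_rungCheckZ {N : ℕ} {logs : List FI} {utab : List (List FI)} {Lz : List (List ℤ)}
    {lamZ : ℤ} (h : rungCheckZ N logs utab Lz lamZ = true) {A : FI} (hA : slopeEncl logs = some A)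
    {ktab : List (List ℕ)} (htab : utab = uTableK logs A N ktab) {M : ℕ} (hM : 2 ≤ M) (hMN : M ≤ N + 1) :
    0 < screwPivot M :=
  screwPivot_pos_of_posDef_le (posDef_of_rungCheckZ h hA htab) M hM hMN

end Summit.RiemannHypothesis.RiemannHypothesis.Theorems.IntegerScrew.RungCert
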